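import Mathlib.GroupTheory.FreeGroup.Reduce
import Mathlib.Tactic.Group
import Mathlib.Tactic.FinCases
import Literature.Topology.FourManifolds.BalancedPresentation

/-!
# Andrews–Curtis certificates: an executable replay checker with a soundness theorem

A *certificate* that a balanced presentation `P` is Andrews–Curtis trivial is a finite list of
elementary moves whose replay, starting from the relator words of `P`, ends at the trivial
presentation `⟨x₀, …, xₙ₋₁ ∣ x₀, …, xₙ₋₁⟩`.  This file provides

* `ACCert.WPres n` — a presentation given by relator WORDS (`List (Fin n × Bool)`, the
  `FreeGroup.mk` encoding), with `ACCert.toPres : WPres n → BalancedPresentation n`;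
* `ACCert.Step n` — the three Andrews–Curtis moves of `AndrewsCurtisMove` (invert `rᵢ`, `rᵢ ↦ rᵢ rⱼ`,
  `rᵢ ↦ x_g rᵢ x_g⁻¹`) plus the derived `rᵢ ↦ x_g⁻¹ rᵢ x_g` (the inverse of a `conj` move), acting on
  words with free reduction (`FreeGroup.reduce`) after each move; `ACCert.replay`;
* the SOUNDNESS THEOREM `ACCert.isAndrewsCurtisEquivalent_replay`: the interpretation of the replayed
  word presentation is `IsAndrewsCurtisEquivalent` to the interpretation of the start, whence
  `ACCert.certify` / `ACCert.certifyEquiv`: a certificate whose replay is checked by `decide` yields a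
  theorem `IsAndrewsCurtisEquivalent P (BalancedPresentation.trivial n)` (resp. `… P Q`);
* `ACCert.akbulutKirbyW k` with `toPres (akbulutKirbyW k) = akbulutKirby k`, so that certificates
  about the Akbulut–Kirby family are stated against the tree's `akbulutKirby`.

The checker is the Lean counterpart of the replay verifiers used for computer searches of
Andrews–Curtis trivialisations (Miasnikov 1999, §2; Havas–Ramsay 2003; Panteleev–Ushakov 2019, §2;
Shehper et al. 2025, §3): a search program emits the move list, the kernel re-executes it.  Nothing in
this file searches.

## Sources

* J. J. Andrews, M. L. Curtis, *Free groups and handlebodies*, Proc. AMS 16 (1965) 192–195 (the moves). [AndrewsCurtis1965PAMS]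
* S. Akbulut, R. Kirby, *A potential smooth counterexample in dimension 4 …*, Topology 24 (1985) (the family `akbulutKirby`). [AkbulutKirby1985Topology]
* A. D. Miasnikov, *Genetic algorithms and the Andrews–Curtis conjecture*, Internat. J. Algebra Comput. 9
  (1999) 671–686, arXiv:math/0304306, §2 (moves, computer verification of AC-trivialisations). [Miasnikov2003]
* D. Panteleev, A. Ushakov, *Conjugacy search problem and the Andrews–Curtis conjecture*, Groups
  Complex. Cryptol. 11 (2019), arXiv:1609.00325, §2. [PanteleevUshakov2016]

## Design

Words are kept freely reduced by applying `FreeGroup.reduce` after every move (so that kernel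
evaluation by `decide` stays cheap); soundness only uses `FreeGroup.reduce.self : mk (reduce L) = mk L`,
`FreeGroup.mul_mk` and `FreeGroup.inv_mk`.  A `mul i i` step is a no-op (the move requires `i ≠ j`).
The derived step `conjInv i g` is justified by `Relation.EqvGen.symm` applied to the `conj` move from
its result back to the start.
-/

namespace Literature.Topology.FourManifolds

namespace ACCert

variable {n : ℕ}

/-- A balanced presentation given by relator words: relator `i` is a list of letters
`(generator, sign)` in the `FreeGroup.mk` encoding (`(g, true)` = `x_g`, `(g, false)` = `x_g⁻¹`).
(Andrews–Curtis 1965.) [folklore] -/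
abbrev WPres (n : ℕ) : Type := Fin n → List (Fin n × Bool)

/-- Interpretation of a word presentation as a `BalancedPresentation` (relator-wise `FreeGroup.mk`).
(Andrews–Curtis 1965.) [folklore] -/
def toPres (P : WPres n) : BalancedPresentation n := fun i ↦ FreeGroup.mk (P i)

/-- Certificate steps: the three Andrews–Curtis moves (`inv`: `rᵢ ↦ rᵢ⁻¹`; `mul`: `rᵢ ↦ rᵢ rⱼ`;
`conj`: `rᵢ ↦ x_g rᵢ x_g⁻¹`) and the derived `conjInv`: `rᵢ ↦ x_g⁻¹ rᵢ x_g`.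
(Andrews–Curtis 1965; Miasnikov 1999, §2.) [cite: AndrewsCurtis1965PAMS] -/
inductive Step (n : ℕ) : Type
  | inv (i : Fin n)
  | mul (i j : Fin n)
  | conj (i g : Fin n)
  | conjInv (i g : Fin n)
  deriving Repr, DecidableEq

/-- Apply one certificate step to a word presentation, freely reducing the changed relator.
(Andrews–Curtis 1965; Miasnikov 1999, §2.) [folklore] -/
def apply (P : WPres n) : Step n → WPres n
  | .inv i => Function.update P i (FreeGroup.reduce (FreeGroup.invRev (P i)))
  | .mul i j => if i = j then P else Function.update P i (FreeGroup.reduce (P i ++ P j))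
  | .conj i g => Function.update P i (FreeGroup.reduce ((g, true) :: (P i ++ [(g, false)])))
  | .conjInv i g => Function.update P i (FreeGroup.reduce ((g, false) :: (P i ++ [(g, true)])))

/-- Replay a list of certificate steps. (Miasnikov 1999, §2.) [folklore] -/
def replay (P : WPres n) : List (Step n) → WPres n
  | [] => P
  | s :: ss => replay (apply P s) ss

/-- Boolean test: the word presentation is literally the trivial presentation, relator `i` = `[x_i]`.
(Andrews–Curtis 1965.) [folklore] -/
def isTrivial (P : WPres n) : Bool := (List.finRange n).all fun i ↦ P i == [(i, true)]

/-- Boolean test: two word presentations have literally the same relator words. [folklore] -/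
def eqb (P Q : WPres n) : Bool := (List.finRange n).all fun i ↦ P i == Q i

/-- `toPres` commutes with updating one relator. [folklore] -/
theorem toPres_update (P : WPres n) (i : Fin n) (w : List (Fin n × Bool)) :
    toPres (Function.update P i w) = Function.update (toPres P) i (FreeGroup.mk w) := by
  funext j
  by_cases h : j = i
  · subst h; simp [toPres]
  · simp [toPres, Function.update_of_ne h]

/-- Conjugating a word by a generator letter, read in the free group. [folklore] -/
theorem mk_conj_eq (w : List (Fin n × Bool)) (g : Fin n) :
    FreeGroup.mk ((g, true) :: (w ++ [(g, false)])) =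
      FreeGroup.of g * FreeGroup.mk w * (FreeGroup.of g)⁻¹ := by
  rw [FreeGroup.of, FreeGroup.inv_mk, FreeGroup.mul_mk, FreeGroup.mul_mk]
  rfl

/-- Conjugating a word by the inverse of a generator letter, read in the free group. [folklore] -/
theorem mk_conjInv_eq (w : List (Fin n × Bool)) (g : Fin n) :
    FreeGroup.mk ((g, false) :: (w ++ [(g, true)])) =
      (FreeGroup.of g)⁻¹ * FreeGroup.mk w * FreeGroup.of g := by
  rw [FreeGroup.of, FreeGroup.inv_mk, FreeGroup.mul_mk, FreeGroup.mul_mk]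
  rfl

/-- SOUNDNESS OF ONE STEP: the interpretation of `apply P s` is Andrews–Curtis equivalent to the
interpretation of `P` (one `AndrewsCurtisMove`, or the inverse of one for `conjInv`, or none for a
degenerate `mul i i`). (Andrews–Curtis 1965.) [cite: AndrewsCurtis1965PAMS] -/
theorem isAndrewsCurtisEquivalent_apply (P : WPres n) (s : Step n) :
    IsAndrewsCurtisEquivalent (toPres P) (toPres (apply P s)) := by
  cases s with
  | inv i =>
    rw [apply, toPres_update, FreeGroup.reduce.self, ← FreeGroup.inv_mk]
    exact Relation.EqvGen.rel _ _ (AndrewsCurtisMove.inv (toPres P) i)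
  | mul i j =>
    by_cases h : i = j
    · rw [apply, if_pos h]
      exact Relation.EqvGen.refl _
    · rw [apply, if_neg h, toPres_update, FreeGroup.reduce.self, ← FreeGroup.mul_mk]
      exact Relation.EqvGen.rel _ _ (AndrewsCurtisMove.mul (toPres P) i j h)
  | conj i g =>
    rw [apply, toPres_update, FreeGroup.reduce.self, mk_conj_eq]
    exact Relation.EqvGen.rel _ _ (AndrewsCurtisMove.conj (toPres P) i g)
  | conjInv i g =>
    rw [apply, toPres_update, FreeGroup.reduce.self, mk_conjInv_eq]
    refine Relation.EqvGen.symm _ _ (?_)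
    have hmove := AndrewsCurtisMove.conj
      (Function.update (toPres P) i ((FreeGroup.of g)⁻¹ * FreeGroup.mk (P i) * FreeGroup.of g)) i g
    have hback : Function.update
        (Function.update (toPres P) i ((FreeGroup.of g)⁻¹ * FreeGroup.mk (P i) * FreeGroup.of g)) i
        (FreeGroup.of g *
          Function.update (toPres P) i ((FreeGroup.of g)⁻¹ * FreeGroup.mk (P i) * FreeGroup.of g) i *
          (FreeGroup.of g)⁻¹) = toPres P := by
      rw [Function.update_self, Function.update_idem]
      have : FreeGroup.of g * ((FreeGroup.of g)⁻¹ * FreeGroup.mk (P i) * FreeGroup.of g) *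
          (FreeGroup.of g)⁻¹ = toPres P i := by
        simp only [toPres]; group
      rw [this, Function.update_eq_self]
    rw [hback] at hmove
    exact Relation.EqvGen.rel _ _ hmove

/-- SOUNDNESS OF REPLAY: the interpretation of the replayed presentation is Andrews–Curtis
equivalent to the interpretation of the start. (Andrews–Curtis 1965.) [cite: AndrewsCurtis1965PAMS] -/
theorem isAndrewsCurtisEquivalent_replay (P : WPres n) (ss : List (Step n)) :
    IsAndrewsCurtisEquivalent (toPres P) (toPres (replay P ss)) := by
  induction ss generalizing P with
  | nil => exact Relation.EqvGen.refl _
  | cons s ss ih => exact Relation.EqvGen.trans _ _ _ (isAndrewsCurtisEquivalent_apply P s) (ih _)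

/-- A word presentation passing `isTrivial` interprets to the trivial presentation. [folklore] -/
theorem toPres_eq_trivial_of_isTrivial (P : WPres n) (h : isTrivial P = true) :
    toPres P = BalancedPresentation.trivial n := by
  funext i
  have hi : P i = [(i, true)] := by
    have := List.all_eq_true.1 h i (List.mem_finRange i)
    simpa using this
  simp [toPres, BalancedPresentation.trivial, hi, FreeGroup.of]

/-- Word presentations passing `eqb` have equal interpretations. [folklore] -/
theorem toPres_eq_of_eqb (P Q : WPres n) (h : eqb P Q = true) : toPres P = toPres Q := by
  funext i
  have hi : P i = Q i := by
    have := List.all_eq_true.1 h i (List.mem_finRange i)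
    simpa using this
  simp [toPres, hi]

/-- CERTIFICATE THEOREM (trivialisation): if the replay of the steps `ss` from the word presentation
`P` is literally trivial — a closed Boolean condition, checked by `decide` — then the presentation
`P'` interpreted by `P` is Andrews–Curtis equivalent to the trivial presentation.
(Andrews–Curtis 1965; Miasnikov 1999, §2.) [cite: AndrewsCurtis1965PAMS] -/
theorem certify {P : WPres n} {P' : BalancedPresentation n} (hP : toPres P = P')
    (ss : List (Step n)) (h : isTrivial (replay P ss) = true) :
    IsAndrewsCurtisEquivalent P' (BalancedPresentation.trivial n) := by
  rw [← hP, ← toPres_eq_trivial_of_isTrivial _ h]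
  exact isAndrewsCurtisEquivalent_replay P ss

/-- CERTIFICATE THEOREM (equivalence): if the replay of `ss` from `P` is literally the word
presentation `Q`, the interpreted presentations are Andrews–Curtis equivalent.
(Andrews–Curtis 1965; Miasnikov 1999, §2.) [cite: AndrewsCurtis1965PAMS] -/
theorem certifyEquiv {P Q : WPres n} {P' Q' : BalancedPresentation n} (hP : toPres P = P')
    (hQ : toPres Q = Q') (ss : List (Step n)) (h : eqb (replay P ss) Q = true) :
    IsAndrewsCurtisEquivalent P' Q' := by
  rw [← hP, ← hQ, ← toPres_eq_of_eqb _ _ h]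
  exact isAndrewsCurtisEquivalent_replay P ss

/-- The Akbulut–Kirby presentations as words: `x^{k+2} y^{-(k+3)}` and `x y x y⁻¹ x⁻¹ y⁻¹`
(`x = x₀`, `y = x₁`), matching `akbulutKirby k`. (Akbulut–Kirby 1985.) [cite: AkbulutKirby1985Topology] -/
def akbulutKirbyW (k : ℕ) : WPres 2 :=
  ![(List.replicate (k + 2) [((0 : Fin 2), true)]).flatten ++
      FreeGroup.invRev (List.replicate (k + 3) [((1 : Fin 2), true)]).flatten,
    [(0, true), (1, true), (0, true)] ++ FreeGroup.invRev [((1 : Fin 2), true), (0, true), (1, true)]]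

/-- The word form interprets to the tree's `akbulutKirby k`. (Akbulut–Kirby 1985.) [cite: AkbulutKirby1985Topology] -/
theorem toPres_akbulutKirbyW (k : ℕ) : toPres (akbulutKirbyW k) = akbulutKirby k := by
  funext i
  fin_cases i <;>
    simp [toPres, akbulutKirbyW, akbulutKirby, FreeGroup.of, FreeGroup.pow_mk, FreeGroup.mul_mk,
      FreeGroup.inv_mk]

end ACCert

end Literature.Topology.FourManifolds
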